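import Literature.IUT.HodgeArakelov.CuspidalInertiaDataNonVacuity
import Literature.AnabelianGeometry.SemiGraphs.TemperedCompletionExistence
import HarnessLib

/-!
# [IUTchII] Def 2.3 (i)(ii) / B15 core: the agreement `StableCurveAgreement W C D` from a COMMON PROFINITE COMPLETION

S. Mochizuki, *Inter-universal Teichmüller Theory II*, kurims manuscript (Dec. 2020), §2, Def 2.3 (i) p. 67 («`Π^±_v := Π^tp_{X_v}`,
`Π̂^±_v := Π̂_{X_v}`» — the SAME profinite completion on the [IUTchII] side and on the [IUTchI] §2 side) and (ii) p. 68;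
*Inter-universal Teichmüller Theory I* (May 2020), §2 p. 46; [SemiAnbd] §6 p. 69 («the profinite completion», unique up to a unique
isomorphism) [cite: Mochizuki2012, II Def 2.3 (i)(ii) pp.67–68; I §2 p.46] [cite: MochizukiSemiAnbd2006, §6 p.69].  abc-iut cell,
MERGE-MAP candidate row **B15** «common-model identification at `v ∈ 𝕍^bad`» (plan/L6/MERGE-MAP.md v31–32, SHAPES
HOME/staging/L6/L6-t7/B15-SHAPES.md), piece 3 GENERIC CORE; seat abc-iut-w5-d132 (gen 4).  PROOF-ONLY (no `def`, no `instance`,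
no `structure`), over LANDED modules only.

THE POINT.  abc-iut-L6-t7's agreement structure `PlusMinusTower.StableCurveAgreement W C D` asks for a group isomorphism
`eHat : Π̂^±_v ⥲ Π̂_X` carrying `Π^±_v` onto `ι(Π^tp_X)`, `Δ̂^±_v` onto `Δ̂_X`, and the cuspidal inertia groups onto the conjugates of the
`I_x`.  When the tower `W` ([IUTchII] side; e.g. abc-iut-L6-t19's genuine `PlusMinusTower.ofPiCHat`, p430122) and the stable-curve datum
`D` ([IUTchI] §2 side; e.g. abc-iut-L5's `StableCurveTemperedData.ofSpecialFibre`) are built from the SAME tempered group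
`Π^tp_{X̲_v}` — `Π̂^±_v` a profinite completion of `Π^±_v` through `emb`, `Π̂_X` a profinite completion of `Π^tp_X` through `ιX`,
the tempered groups identified by `φ : Π^±_v ≅ Π^tp_X`, the augmentations compatible through an injective `σ : G_v → G_k` —
then `eHat` is the UNIQUENESS ISOMORPHISM of the profinite completion (abc-iut-L3 `IsProfiniteCompletion.nonempty_continuousMulEquiv`),
`map_piPM` holds by construction, `mem_ker_iff` by uniqueness of continuous extensions (`extension_unique`: `prHat ∘ eHat` and
`σ ∘ aug` agree on the dense `Π^±_v`), and `inertia_iff` by abc-iut-w5-d028's `CuspidalInertiaData.exists_model_of_agreementIso`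
(the cuspidal datum transported from `D`'s cusps).  So piece 3 of B15 reduces to the four concrete facts listed as hypotheses
below, each about ONE side only.

* `IsProfiniteCompletion.comp_continuousMulEquiv_source` — transport of «is a profinite completion» along an isomorphism of the
  SOURCE (the target-side transport is abc-iut-L3's `of_mulEquiv`);
* **`PlusMinusTower.StableCurveAgreement.exists_of_isProfiniteCompletion`** — the agreement (with its cuspidal datum) from:
  `embHat : Π^±_v → Π̂^±_v` (= `emb` corestricted) and `ιXHat : Π^tp_X → Π̂_X` (= `ιX`) profinite completions, `φ : Π^±_v ≃ₜ* Π^tp_X`,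
  `aug|Π̂^±_v` and `prHat` continuous, `σ : G_v →* G_k` injective with `prTp ∘ φ = σ ∘ aug ∘ emb`, `G_k` Hausdorff.

HONEST LABEL: a REDUCTION (genuine content = the uniqueness of profinite completions); it asserts nothing of the series; the absolute
B15 instance needs abc-iut-L3's `TemperedCurve.ofOpenSubgroup` (piece 1) and the L5 datum of `X̲_v`.  No side taken on [IUTchIII] Cor 3.12.
-/

namespace Literature.AnabelianGeometry.SemiGraphs.IsProfiniteCompletion

universe u v w

/-- **Transport of «profinite completion» along an isomorphism of the source** ([SemiAnbd] §6 p. 69: the profinite completion is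
functorial / unique up to unique isomorphism): if `ι : F → F̂` is a profinite completion and `φ : F' ≃ F` an isomorphism of
topological groups, then `ι ∘ φ : F' → F̂` is a profinite completion. [cite: MochizukiSemiAnbd2006, §6 p.69] -/
theorem comp_continuousMulEquiv_source {F : Type u} {F' : Type v} {Fhat : Type w} [Group F] [TopologicalSpace F]
    [IsTopologicalGroup F] [Group F'] [TopologicalSpace F'] [IsTopologicalGroup F'] [Group Fhat] [TopologicalSpace Fhat]
    {ι : F →ₜ* Fhat} (hι : IsProfiniteCompletion ι) (φ : F' ≃ₜ* F) (ι' : F' →ₜ* Fhat) (hι' : ∀ x, ι' x = ι (φ x)) :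
    IsProfiniteCompletion ι' := by
  have hfun : (ι' : F' → Fhat) = ι ∘ φ := funext hι'
  refine
    { compactSpace := hι.compactSpace
      t2Space := hι.t2Space
      totallyDisconnectedSpace := hι.totallyDisconnectedSpace
      denseRange := ?_
      comap_surjective := ?_
      isOpen_comap := ?_ }
  · rw [DenseRange, hfun]
    exact hι.denseRange.comp φ.surjective.denseRange ι.continuous
  · intro U' hU'
    -- push `U'` forward along `φ`: an open normal subgroup of finite index of `F`
    haveI : (U'.toSubgroup.map φ.toMulEquiv.toMonoidHom).Normal :=
      Subgroup.Normal.map U'.isNormal' _ φ.surjective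
    have hopen : IsOpen ((U'.toSubgroup.map φ.toMulEquiv.toMonoidHom : Subgroup F) : Set F) := by
      rw [Subgroup.coe_map]
      exact φ.toHomeomorph.isOpenMap _ U'.isOpen'
    let U : OpenNormalSubgroup F := { toOpenSubgroup := ⟨U'.toSubgroup.map φ.toMulEquiv.toMonoidHom, hopen⟩ }
    have hUfi : U.toSubgroup.FiniteIndex := by
      change (U'.toSubgroup.map φ.toMulEquiv.toMonoidHom).FiniteIndex
      rw [Subgroup.finiteIndex_iff, Subgroup.index_map_of_bijective φ.bijective]
      exact hU'.index_ne_zero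
    obtain ⟨V, hV⟩ := hι.comap_surjective U hUfi
    refine ⟨V, ?_⟩
    ext x
    have hx : φ x ∈ U.toSubgroup ↔ φ x ∈ V.toSubgroup.comap ι.toMonoidHom := by rw [hV]
    constructor
    · intro h
      have h1 : φ x ∈ U.toSubgroup := ⟨x, h, rfl⟩
      have h2 := hx.mp h1
      rw [Subgroup.mem_comap] at h2 ⊢
      change ι' x ∈ V.toSubgroup
      rw [hι']
      exact h2
    · intro h
      rw [Subgroup.mem_comap] at h
      change ι' x ∈ V.toSubgroup at h
      rw [hι'] at h
      have h2 : φ x ∈ U.toSubgroup := hx.mpr (Subgroup.mem_comap.mpr h)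
      obtain ⟨y, hy, hyx⟩ := h2
      rwa [← φ.injective hyx]
  · intro V
    have hset : ((V.toSubgroup.comap ι'.toMonoidHom : Subgroup F') : Set F') =
        φ ⁻¹' ((V.toSubgroup.comap ι.toMonoidHom : Subgroup F) : Set F) := by
      ext x
      change ι' x ∈ V.toSubgroup ↔ ι (φ x) ∈ V.toSubgroup
      rw [hι']
    rw [hset]
    exact (hι.isOpen_comap V).preimage φ.continuous

end Literature.AnabelianGeometry.SemiGraphs.IsProfiniteCompletion

namespace Literature.IUT.HodgeArakelov

open Literature.IUT.HodgeTheaters Literature.AnabelianGeometry.SemiGraphs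
open scoped Pointwise

universe u

variable {S : BadPlaceSetting.{u}} {P : TopGroup.{u}} {T : TemperedCoverings S P}

namespace PlusMinusTower

namespace StableCurveAgreement

/-- **[IUTchII] Def 2.3 (i)(ii) — THE AGREEMENT FROM A COMMON PROFINITE COMPLETION (B15 core).**  Let `W` be a `±`-tower and `D`
an [IUTchI] §2 stable-curve datum such that: `Π̂^±_v` is a profinite completion of `Π^±_v` through `emb` (`embHat`, `hW`), `Π̂_X` is a
profinite completion of `Π^tp_X` through `ιX` (`ιXHat`, `hD`), the tempered groups are identified by `φ : Π^±_v ≃ₜ* Π^tp_X`, the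
augmentations are continuous (`haug`, `hpr`) and compatible through an injective `σ : G_v → G_k` (`hσ`, `hcompat`), `G_k` Hausdorff.
Then there is a cuspidal-inertia datum `Cu` on the tower (abc-iut-w5-d028's transported datum: its `Π^±_v`-cuspidal groups are the
`Π^tp_X`-conjugates of the `I_x` read through `eHat`) and an AGREEMENT `StableCurveAgreement W Cu D`, whose `eHat` is the uniqueness
isomorphism of the profinite completion (`eHat ∘ emb = ιX ∘ φ`).  PROVED.
([IUTchII] Def 2.3 (i)(ii), kurims pp.67–68) [cite: Mochizuki2012, II Def 2.3 (i)(ii) pp.67–68] [cite: MochizukiSemiAnbd2006, §6 p.69] -/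
theorem exists_of_isProfiniteCompletion (W : PlusMinusTower T) (D : StableCurveTemperedData.{u})
    (embHat : T.Xplain →ₜ* W.pmHat) (hembHat : ∀ x, ((embHat x : W.pmHat) : W.Corhat) = W.emb x)
    (hW : IsProfiniteCompletion embHat)
    (ιXHat : D.PiTp →ₜ* D.PiHat) (hιXHat : ∀ y, ιXHat y = D.ιX y) (hD : IsProfiniteCompletion ιXHat)
    (φ : T.Xplain ≃ₜ* D.PiTp)
    (haug : Continuous (W.aug.comp W.pmHat.subtype)) [T2Space D.Gk] (hpr : Continuous D.prHat)
    (σ : S.Gk →* D.Gk) (hσc : Continuous σ) (hσ : Function.Injective σ)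
    (hcompat : ∀ x : T.Xplain, D.prTp (φ x) = σ (W.aug (W.emb x))) :
    ∃ Cu : CuspidalInertiaData W, ∃ A : StableCurveAgreement W Cu D,
      (∀ x : T.Xplain, A.eHat (embHat x) = D.ιX (φ x)) ∧
      (∀ (Q I : Subgroup W.Corhat), Cu.IsCuspidalInertia Q I ↔
        I ≤ Q ∧ ∃ I₀ : Subgroup W.Corhat, Cu.IsCuspidalInertia W.piPM I₀ ∧ I = I₀ ⊓ Q) := by
  haveI := hW.compactSpace; haveI := hW.t2Space
  haveI := hD.t2Space
  -- `ιX ∘ φ : Π^±_v → Π̂_X` is a profinite completion (transport along the source isomorphism `φ`)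
  let ιφ : T.Xplain →ₜ* D.PiHat := ιXHat.comp ⟨φ.toMulEquiv.toMonoidHom, φ.continuous⟩
  have hιφ : IsProfiniteCompletion ιφ :=
    IsProfiniteCompletion.comp_continuousMulEquiv_source hD φ ιφ fun _ => rfl
  -- the uniqueness isomorphism of the profinite completion
  obtain ⟨e, he⟩ := IsProfiniteCompletion.nonempty_continuousMulEquiv hW hιφ
  have he' : ∀ x : T.Xplain, e (embHat x) = D.ιX (φ x) := fun x => by rw [he x]; exact hιXHat _
  -- `prHat ∘ e = σ ∘ aug` on `Π̂^±_v`: two continuous homomorphisms agreeing on the dense `Π^±_v`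
  let lhs : W.pmHat →ₜ* D.Gk := ⟨D.prHat.comp e.toMulEquiv.toMonoidHom, hpr.comp e.continuous⟩
  let rhs : W.pmHat →ₜ* D.Gk := ⟨σ.comp (W.aug.comp W.pmHat.subtype), hσc.comp haug⟩
  have hagree : lhs = rhs := hW.extension_unique lhs rhs fun x => by
    change D.prHat (e (embHat x)) = σ (W.aug ((embHat x : W.pmHat) : W.Corhat))
    rw [he', hembHat, ← hcompat, ← MonoidHom.comp_apply, D.prHat_comp]
  have hker : ∀ g : W.pmHat, (g : W.Corhat) ∈ W.aug.ker ↔ e g ∈ D.DeltaHat := by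
    intro g
    have h1 : D.prHat (e g) = σ (W.aug (g : W.Corhat)) := by
      change lhs g = rhs g
      rw [hagree]
    rw [MonoidHom.mem_ker, MonoidHom.mem_ker, h1]
    constructor
    · intro h; rw [h, map_one]
    · intro h; exact hσ (by rw [h, map_one])
  -- the cuspidal datum transported from `D` (abc-iut-w5-d028)
  obtain ⟨Cu, hCu, hlev⟩ := CuspidalInertiaData.exists_model_of_agreementIso W D e.toMulEquiv
  refine ⟨Cu, { eHat := e.toMulEquiv, map_piPM := ?_, mem_ker_iff := hker, inertia_iff := hCu }, he', hlev⟩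
  -- `Π^±_v ↦ ι(Π^tp_X)`: `e(embHat(Π^±_v)) = ιX(φ(Π^±_v)) = ιX(Π^tp_X)`
  ext y
  constructor
  · rintro ⟨g, hg, rfl⟩
    rw [SetLike.mem_coe, Subgroup.mem_subgroupOf] at hg
    obtain ⟨x, hx⟩ := hg
    have hgx : g = embHat x := Subtype.ext (by rw [hembHat]; exact hx.symm)
    refine ⟨φ x, ?_⟩
    change D.ιX (φ x) = e g
    rw [hgx, he']
  · rintro ⟨z, rfl⟩
    refine ⟨embHat (φ.symm z), ?_, ?_⟩
    · rw [SetLike.mem_coe, Subgroup.mem_subgroupOf, hembHat]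
      exact ⟨φ.symm z, rfl⟩
    · change e (embHat (φ.symm z)) = D.ιX z
      rw [he', ContinuousMulEquiv.apply_symm_apply]

end StableCurveAgreement

end PlusMinusTower

end Literature.IUT.HodgeArakelov
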